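/-
Copyright (c) 2026 the pub-hodgecm-mathlib formalisation cell (harness21).  Prover seat hodgecm-mathlib-LH4-p08 (g5), Track A «(D-RAM) FOUR-FRAME», unit U2H, the census leaf
(ρ2b′-X) `stub_U2H_fixedPointCensus_typeTwo_unit0` — dealer LH4-plan (g12) WORD #16∕#21∕#27 hand T5a «TORIC LEVEL CENSUS» (payer LH4-p14; plan owner LH4-p12 (g4)):
the (R1-TOP-SIDE) closed-form bit law — PREPARATORY LEMMAS (trace-one integers, the `d − 1` gain of `(1−ρ)(1−Θ)`, the upper bound and the existence lemma).  2026-09-04.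
-/
import Summits.HodgeConjecture.HodgeConjecture.Theorems.F0P3cDyRamToricLevelCensusUnrAniso     -- ★ p857464 (this lineage): brings ★ `WildQuadraticDatumNormOneQuotient` ∕ `…Trace` ∕ `WildQuadraticEisensteinFrame` ∕ `QuadraticOrderLevelClasses`
import Literature.NumberTheory.LocalFields.WildQuadraticDatumNormSurjective                    -- ★ (LH4-p02 (g12)): `exists_mul_map_eq_of_fixed_of_v_sub_one_le` (Serre V §3 Cor. 3, sharp norm preimages)
import HarnessLib

/-!
# T5a: the (R1-TOP-SIDE) bit law — preparatory lemmas: how close is `κ = ρμ∕μ` to the torus `T♮ = {x ∈ K♮ : x·ρx = 1}`?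

Frame: one-field currency for `M` (`K` below) with commuting isometric involutions `ρ` (fixing `E`) and `Θ` (fixing the third field `K♮`), `M ∕ E` unramified with
integral generator `α` (`|α − ρα| = 1`), `ϖE` a `ρ`-fixed uniformiser; the third field presented as its own valued field `K'` (datum `(σ', π', d)`, residue field finite)
embedded by `jK` onto the `Θ`-fixed elements; unit-norm surjectivity `hnorm` of `M ∕ K♮`.  For a `ρ`-norm-one `κ` (`κρκ = 1`) put `L := v(κ − Θκ)`.  THE MECHANISM of
the sheet-v5 bit law (the depth at which `κ` dies in `T_M ∕ T♮` is `L − d + 1`), proved here WITHOUT a type for the fourth field `K_τ` and without the `E`-side different: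
* §1 TRACE-ONE INTEGERS: `a₀ = −ρα∕(α − ρα)` (`a₀ + ρa₀ = 1`, `|a₀| ≤ 1`); and a `Θ`-trace-one integer `b` — `½` when `|2| = 1`, and when `|2| < 1` from a unit `β` with
  `|β − Θβ| = 1`, whose existence is FORCED by `hnorm` at the `Θ`-fixed unit `1 + π` (were `Θ` trivial on residues, `N_Θ(1 + e) − 1 = e + Θe + eΘe` would have valuation
  `≤ |π|²` for every `|e| ≤ |π|`);
* §2 THE GAIN: `|k − ρk| ≤ |k|·|π|^{d−1}` for `Θ`-fixed `k` (fixed coordinates `k' = a + bπ'` in `K'`, `k' − σ'k' = b(π' − σ'π')`), hence `|(1−ρ)(1−Θ)c| ≤ |(1−Θ)c|·|π|^{d−1}`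
  for EVERY `c` (a `Θ`-skew element is `(ϖE − ΘϖE)·k` with `k` `Θ`-fixed, and `ϖE − ΘϖE` is `ρ`-fixed);
* §3 UPPER BOUND: `yρy = 1`, `|y − 1| ≤ exp(−s)`, `s ≥ 1` ⇒ `|y − Θy| ≤ max(exp(−(s + d − 1)), exp(−2s))` — `y = ρz∕z` with `z = 1 + ρ(a₀(y − 1))` and
  `ρz·Θz − z·Θρz = −[(1−ρ)(1−Θ)c + (1−ρ)(c·Θρc)]`;
* §4 EXISTENCE (`[IsAdicComplete 𝓂[K'] 𝒪[K']]`): `κρκ = 1`, `|κ − Θκ| ≤ exp(−jl)`, `2d ≤ jl + 1` ⇒ some `Θ`-fixed `ρ`-norm-one `x` has `|κ − x| ≤ exp(−(jl − d + 1))` —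
  `κ_a = Tr_Θ(bκ) ∈ K♮` is within `exp(−jl)` of `κ`, `f = κ_a·ρκ_a ∈ F` is within `exp(−jl)` of `1`, ★ Serre V §3 Cor. 3 on `K'` writes `f = N·ρN` with
  `|N − 1| ≤ exp(−(jl − d + 1))`, and `x = κ_a∕N`;
* §5 COSET REPRESENTATIVES in `K'`: a norm-one `x'` is `a∕σ'a` with `|a| = 1` or `|a| = |π'|` (Hilbert 90 ★ rescaled by the fixed `(π'σ'π')^k`).
HONEST LABEL: HC_CM is proved only modulo the 7 printed citations (2 remaining named inputs: hLiu418 = stmt-HodgeConjecture-24832,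
h413 = stmt-HodgeConjecture-24833) until rung 0 closes; (ρ2b′-X) :418 is an OPEN prover target — this file is a helper (`--supports`), proofs only.
-/

set_option autoImplicit false

open WithZero IsLocalRing
open scoped Valued

namespace Summit.HodgeConjecture.HodgeConjecture.Cruxes.H413.F0P3cDyRamToricLevelCensusUnr

open Literature.NumberTheory.LocalFields (exists_fixed_coords_of_map_ne v_fixed_add_fixed_mul_eq_max)
open Literature.NumberTheory.LocalFields.QuadraticOrder Literature.NumberTheory.LocalFields.WildQuadraticDatum

variable {K : Type*} [Field K] [Valued K ℤᵐ⁰] {ρ Θ : K →+* K} {α ϖE : K} {d t : ℕ}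
variable {K' : Type*} [Field K'] [Valued K' ℤᵐ⁰] {σ' : K' →+* K'} {π' : K'}

/-! ## §0 Discreteness bookkeeping -/

/-- In `ℤᵐ⁰`, `x < exp j` forces `x ≤ exp (j − 1)` (discreteness of the value group). [cite: Serre1979, Ch. II §1] -/
theorem le_exp_sub_one_of_lt_exp {x : ℤᵐ⁰} {j : ℤ} (h : x < exp j) : x ≤ exp (j - 1) := by
  rcases eq_or_ne x 0 with rfl | hx
  · exact zero_le
  · obtain ⟨n, rfl⟩ : ∃ n : ℤ, x = exp n := ⟨log x, (exp_log hx).symm⟩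
    rw [exp_lt_exp] at h
    rw [exp_le_exp]; omega

/-! ## §1 Trace-one integers -/

/-- **THE `ρ`-TRACE-ONE INTEGER OF AN UNRAMIFIED QUADRATIC INVOLUTION**: if `|β| ≤ 1` and `|β − ρβ| = 1` then `a₀ := −ρβ∕(β − ρβ)` has `a₀ + ρa₀ = 1` and `|a₀| ≤ 1`
(`Tr 𝒪_M = 𝒪_E` made explicit). [cite: Serre1979, Ch. III §3 Prop. 7] [cite: Serre1979, Ch. V §2] -/
theorem exists_traceOne_of_unramified (hρρ : ∀ x, ρ (ρ x) = x) (hvρ : ∀ x, Valued.v (ρ x) = Valued.v x) {β : K} (hβ1 : Valued.v β ≤ 1)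
    (hβ : Valued.v (β - ρ β) = 1) : ∃ a₀ : K, Valued.v a₀ ≤ 1 ∧ a₀ + ρ a₀ = 1 := by
  have hδ0 : β - ρ β ≠ 0 := fun h0 => by rw [h0, map_zero] at hβ; exact zero_ne_one hβ
  have hδ0' : ρ β - β ≠ 0 := fun h0 => hδ0 (by linear_combination (-1 : K) * h0)
  refine ⟨-ρ β / (β - ρ β), ?_, ?_⟩
  · rw [map_div₀, Valuation.map_neg, hvρ, hβ, div_one]; exact hβ1
  · rw [map_div₀, map_neg, map_sub, hρρ]
    field_simp
    ring

/-- **A UNIT MOVED BY `Θ` TO DISTANCE ONE, FORCED BY UNIT-NORM SURJECTIVITY (wild case `|2| < 1`).**  If every `Θ`-fixed unit is a norm `ωΘω` (`hnorm`) and `π` is a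
`Θ`-fixed uniformiser, then some integer `β` has `|β − Θβ| = 1`: otherwise `|x − Θx| ≤ |π|·|x|` for all `x`, and for `ωΘω = 1 + π` (after the sign change `ω ↦ −ω` if needed,
`|ω − 1| ≤ |π|`) `π = e + Θe + eΘe` with `e = ω − 1` would have valuation `≤ |π|²` (`e + Θe = 2e − (e − Θe)`, `|2| ≤ |π|`). [cite: Serre1979, Ch. V §2 Prop. 3] -/
theorem exists_v_sub_map_eq_one_of_hnorm (hΘΘ : ∀ x, Θ (Θ x) = x) (hvΘ : ∀ x, Valued.v (Θ x) = Valued.v x) {π : K} (hΘπ : Θ π = π)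
    (hπ : Valued.v π = exp (-1 : ℤ)) (h2 : Valued.v (2 : K) = Valued.v π ^ t) (ht : 1 ≤ t)
    (hnorm : ∀ z : Kˣ, Θ (z : K) = z → Valued.v (z : K) = 1 → ∃ ω : Kˣ, Valued.v (ω : K) = 1 ∧ (ω : K) * Θ ω = z) :
    ∃ β : K, Valued.v β ≤ 1 ∧ Valued.v (β - Θ β) = 1 := by
  by_contra H'
  have H : ∀ β : K, Valued.v β ≤ 1 → Valued.v (β - Θ β) ≠ 1 := fun β h1 h2 => H' ⟨β, h1, h2⟩
  have hv1 : Valued.v (1 : K) = 1 := Valuation.map_one _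
  have hπ0 : π ≠ 0 := (v_varpi_zpow hπ 0).1
  have hπ1 : Valued.v π < 1 := by rw [hπ, ← exp_zero, exp_lt_exp]; omega
  -- (i) `Θ` is trivial on residues: `|x − Θx| ≤ exp(−1)` for every integer `x`
  have hres : ∀ x : K, Valued.v x ≤ 1 → Valued.v (x - Θ x) ≤ exp (-1 : ℤ) := fun x hx => by
    have hle : Valued.v (x - Θ x) ≤ 1 := (Valuation.map_sub _ _ _).trans (max_le hx (by rw [hvΘ]; exact hx))
    have hlt : Valued.v (x - Θ x) < exp (0 : ℤ) := by rw [exp_zero]; exact lt_of_le_of_ne hle (H x hx)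
    simpa using le_exp_sub_one_of_lt_exp hlt
  -- (ii) scaled along the `Θ`-fixed uniformiser: `|x − Θx| ≤ |x|·exp(−1)` for every `x`
  have hscal : ∀ x : K, Valued.v (x - Θ x) ≤ Valued.v x * exp (-1 : ℤ) := fun x => by
    rcases eq_or_ne x 0 with rfl | hx0
    · rw [map_zero, sub_zero, map_zero, zero_mul]
    · obtain ⟨k, ω, hω, hx⟩ := exists_eq_varpi_zpow_mul_unit hπ hx0
      have hΘx : Θ x = π ^ k * Θ ω := by rw [hx, map_mul, map_zpow₀, hΘπ]
      have hsub : x - Θ x = π ^ k * (ω - Θ ω) := by rw [hΘx, hx]; ring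
      have hvx : Valued.v x = Valued.v (π ^ k) := by rw [hx, map_mul, hω, mul_one]
      rw [hsub, map_mul, hvx]
      exact mul_le_mul' le_rfl (hres ω hω.le)
  -- (iii) the `Θ`-fixed unit `1 + π` is a norm `ωΘω`
  have h1π : Valued.v (1 + π) = 1 := by
    rw [Valuation.map_add_eq_of_lt_left Valued.v (x := (1 : K)) (y := π) (by rw [hv1]; exact hπ1), hv1]
  have h1π0 : 1 + π ≠ 0 := fun h0 => by rw [h0, map_zero] at h1π; exact zero_ne_one h1π
  obtain ⟨ω, hω, hωN⟩ := hnorm (Units.mk0 (1 + π) h1π0) (by rw [Units.val_mk0, map_add, map_one, hΘπ]) (by rw [Units.val_mk0, h1π])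
  rw [Units.val_mk0] at hωN
  -- (iv) after a sign change, `|ω − 1| ≤ exp(−1)`
  obtain ⟨ω₁, hω₁N, he⟩ : ∃ ω₁ : K, ω₁ * Θ ω₁ = 1 + π ∧ Valued.v (ω₁ - 1) ≤ exp (-1 : ℤ) := by
    have hprod : (ω : K) - 1 ≠ 0 → Θ (ω : K) + 1 ≠ 0 →
        Valued.v ((ω : K) - 1) * Valued.v (Θ (ω : K) + 1) ≤ exp (-1 : ℤ) := fun _ _ => by
      have hid : ((ω : K) - 1) * (Θ (ω : K) + 1) = π + ((ω : K) - Θ ω) := by linear_combination hωN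
      rw [← map_mul, hid]
      refine (Valuation.map_add _ _ _).trans (max_le hπ.le ?_)
      exact (hscal ω).trans (by rw [hω, one_mul])
    by_cases hlt : Valued.v ((ω : K) - 1) < 1
    · exact ⟨ω, hωN, by simpa using le_exp_sub_one_of_lt_exp (j := 0) (by rwa [exp_zero])⟩
    · -- `|ω − 1| = 1`, so `|Θω + 1| ≤ exp(−1)` and `−ω` works
      have hω1 : Valued.v ((ω : K) - 1) = 1 :=
        le_antisymm ((Valuation.map_sub _ _ _).trans (max_le hω.le hv1.le)) (not_lt.1 hlt)
      have hω10 : (ω : K) - 1 ≠ 0 := fun h0 => by rw [h0, map_zero] at hω1; exact zero_ne_one hω1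
      refine ⟨-(ω : K), by rw [map_neg, neg_mul_neg, hωN], ?_⟩
      have hneg : -(ω : K) - 1 = -(Θ (Θ (ω : K) + 1)) := by rw [map_add, hΘΘ, map_one]; ring
      rw [hneg, Valuation.map_neg, hvΘ]
      by_cases h0 : Θ (ω : K) + 1 = 0
      · rw [h0, map_zero]; exact zero_le
      · have := hprod hω10 h0
        rwa [hω1, one_mul] at this
  -- (v) `π = e + Θe + eΘe` with `e = ω₁ − 1` has valuation `≤ exp(−2)`: contradiction
  obtain ⟨e, rfl⟩ : ∃ e : K, ω₁ = 1 + e := ⟨ω₁ - 1, by ring⟩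
  rw [add_sub_cancel_left] at he
  have hπe : π = (2 * e - (e - Θ e)) + e * Θ e := by
    rw [map_add, map_one] at hω₁N
    linear_combination (-1 : K) * hω₁N
  have h2e : Valued.v (2 * e) ≤ exp (-2 : ℤ) := by
    rw [map_mul, h2, hπ, ← exp_nsmul, nsmul_eq_mul, mul_neg, mul_one]
    calc exp (-(t : ℤ)) * Valued.v e ≤ exp (-1 : ℤ) * exp (-1 : ℤ) :=
          mul_le_mul' (by rw [exp_le_exp]; omega) he
      _ = exp (-2 : ℤ) := by rw [← exp_add]; norm_num
  have hee : Valued.v (e - Θ e) ≤ exp (-2 : ℤ) :=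
    (hscal e).trans (by
      calc Valued.v e * exp (-1 : ℤ) ≤ exp (-1 : ℤ) * exp (-1 : ℤ) := mul_le_mul' he le_rfl
        _ = exp (-2 : ℤ) := by rw [← exp_add]; norm_num)
  have heΘe : Valued.v (e * Θ e) ≤ exp (-2 : ℤ) := by
    rw [map_mul, hvΘ]
    calc Valued.v e * Valued.v e ≤ exp (-1 : ℤ) * exp (-1 : ℤ) := mul_le_mul' he he
      _ = exp (-2 : ℤ) := by rw [← exp_add]; norm_num
  have hle : Valued.v π ≤ exp (-2 : ℤ) := by
    rw [hπe]
    exact (Valuation.map_add _ _ _).trans (max_le ((Valuation.map_sub _ _ _).trans (max_le h2e hee)) heΘe)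
  rw [hπ, exp_le_exp] at hle
  omega

/-- **A `Θ`-TRACE-ONE INTEGER** (`b + Θb = 1`, `|b| ≤ 1`) for the unramified `M ∕ K♮` presented by unit-norm surjectivity: `b = ½` when `|2| = 1` (`t = 0`), otherwise
`b = −Θβ∕(β − Θβ)` with `β` from `exists_v_sub_map_eq_one_of_hnorm`. [cite: Serre1979, Ch. III §3 Prop. 7] [cite: Serre1979, Ch. V §2 Prop. 3] -/
theorem exists_traceOne_theta (hΘΘ : ∀ x, Θ (Θ x) = x) (hvΘ : ∀ x, Valued.v (Θ x) = Valued.v x) {π : K} (hΘπ : Θ π = π)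
    (hπ : Valued.v π = exp (-1 : ℤ)) (h2 : Valued.v (2 : K) = Valued.v π ^ t)
    (hnorm : ∀ z : Kˣ, Θ (z : K) = z → Valued.v (z : K) = 1 → ∃ ω : Kˣ, Valued.v (ω : K) = 1 ∧ (ω : K) * Θ ω = z) :
    ∃ b : K, Valued.v b ≤ 1 ∧ b + Θ b = 1 := by
  rcases Nat.eq_zero_or_pos t with ht | ht
  · -- tame: `b = 1/2`
    subst ht
    rw [pow_zero] at h2
    refine ⟨1 / 2, le_of_eq (by rw [map_div₀, map_one, h2, div_one]), ?_⟩
    rw [map_div₀, map_one, map_ofNat]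
    have h20 : (2 : K) ≠ 0 := fun h0 => by rw [h0, map_zero] at h2; exact zero_ne_one h2
    field_simp
    norm_num
  · obtain ⟨β, hβ1, hβ⟩ := exists_v_sub_map_eq_one_of_hnorm hΘΘ hvΘ hΘπ hπ h2 ht hnorm
    exact exists_traceOne_of_unramified hΘΘ hvΘ hβ1 hβ

/-! ## §2 The gain `d − 1` -/

/-- **`Θ`-FIXED ELEMENTS ARE `ρ`-DEEP**: for `Θ`-fixed `k` (so `k = jK k'`), `|k − ρk| ≤ |k|·exp(−(d − 1))` — in fixed coordinates `k' = a + bπ'`, `k' − σ'k' = b(π' − σ'π')`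
and `|k'| = max(|a|, |b||π'|) ≥ |b||π'|`. [cite: Serre1979, Ch. IV §1 Prop. 2] [cite: Serre1979, Ch. V §3] -/
theorem v_sub_map_le_of_thetaFixed (hσ' : ∀ x, σ' (σ' x) = x) (hfix' : ∀ x : K', σ' x = x → x ≠ 0 → ∃ n : ℤ, Valued.v x = exp (2 * n))
    (hπ' : Valued.v π' = exp (-1 : ℤ)) (hdd' : Valued.v (π' - σ' π') = Valued.v π' ^ d)
    (jK : K' →+* K) (hjv : ∀ x, Valued.v (jK x) = Valued.v x) (hjfix : ∀ z : K, Θ z = z → ∃ x, jK x = z) (hjσ : ∀ x, jK (σ' x) = ρ (jK x))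
    {k : K} (hk : Θ k = k) : Valued.v (k - ρ k) ≤ Valued.v k * exp (-((d : ℤ) - 1)) := by
  obtain ⟨k', rfl⟩ := hjfix k hk
  rw [← hjσ, ← map_sub, hjv, hjv]
  obtain ⟨a, b, ha, hb, hk'⟩ := exists_fixed_coords_of_map_ne hσ' (map_varpi_ne hπ' hdd') k'
  have hsub : k' - σ' k' = b * (π' - σ' π') := by rw [hk', map_add, map_mul, ha, hb]; ring
  have hvk' : Valued.v b * exp (-1 : ℤ) ≤ Valued.v k' := by
    rw [hk', v_fixed_add_fixed_mul_eq_max (even_log_v_of_fixed hfix') hπ' ha hb]; exact le_max_right _ _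
  have hexp : exp (-1 : ℤ) * exp (-((d : ℤ) - 1)) = Valued.v π' ^ d := by
    rw [hπ', ← exp_nsmul, nsmul_eq_mul, ← exp_add]; congr 1; ring
  rw [hsub, map_mul, hdd', ← hexp, ← mul_assoc]
  exact mul_le_mul' hvk' le_rfl

/-- **THE COMPOSITE GAIN**: for EVERY `c`, `|(c − Θc) − ρ(c − Θc)| ≤ |c − Θc|·exp(−(d − 1))` — the `Θ`-skew element `c − Θc` is `(ϖE − ΘϖE)·k` with `k` `Θ`-fixed, and
`ϖE − ΘϖE` is `ρ`-fixed (`ρΘ = Θρ`) and NON-ZERO (a `Θ`-fixed `ϖE` would be a `σ'`-fixed element of `K'` of odd valuation). [cite: Serre1979, Ch. IV §1 Prop. 2] [cite: Serre1979, Ch. V §3] -/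
theorem v_skew_sub_map_skew_le (hΘΘ : ∀ x, Θ (Θ x) = x) (hΘρ : ∀ x, Θ (ρ x) = ρ (Θ x)) (hρϖE : ρ ϖE = ϖE) (hϖE : Valued.v ϖE = exp (-1 : ℤ))
    (hσ' : ∀ x, σ' (σ' x) = x) (hfix' : ∀ x : K', σ' x = x → x ≠ 0 → ∃ n : ℤ, Valued.v x = exp (2 * n))
    (hπ' : Valued.v π' = exp (-1 : ℤ)) (hdd' : Valued.v (π' - σ' π') = Valued.v π' ^ d)
    (jK : K' →+* K) (hjv : ∀ x, Valued.v (jK x) = Valued.v x) (hjfix : ∀ z : K, Θ z = z → ∃ x, jK x = z) (hjσ : ∀ x, jK (σ' x) = ρ (jK x))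
    (c : K) : Valued.v ((c - Θ c) - ρ (c - Θ c)) ≤ Valued.v (c - Θ c) * exp (-((d : ℤ) - 1)) := by
  -- the skew scalar `s₀ = ϖE − ΘϖE ≠ 0`
  have hs0 : ϖE - Θ ϖE ≠ 0 := by
    intro h0
    have hΘϖ : Θ ϖE = ϖE := (sub_eq_zero.1 h0).symm
    obtain ⟨x, hx⟩ := hjfix ϖE hΘϖ
    have hσx : σ' x = x := jK.injective (by rw [hjσ, hx, hρϖE])
    have hx0 : x ≠ 0 := by rintro rfl; rw [map_zero] at hx; exact (v_varpi_zpow hϖE 0).1 hx.symm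
    obtain ⟨n, hn⟩ := hfix' x hσx hx0
    rw [← hjv, hx, hϖE, exp_inj] at hn
    omega
  have hρs : ρ (ϖE - Θ ϖE) = ϖE - Θ ϖE := by rw [map_sub, hρϖE, ← hΘρ, hρϖE]
  -- `k := (c − Θc) ∕ s₀` is `Θ`-fixed
  obtain ⟨k, hkdef⟩ : ∃ k : K, k = (c - Θ c) / (ϖE - Θ ϖE) := ⟨_, rfl⟩
  have hΘk : Θ k = k := by
    rw [hkdef, map_div₀, map_sub, map_sub, hΘΘ, hΘΘ, ← neg_sub c, ← neg_sub ϖE, neg_div_neg_eq]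
  have hck : c - Θ c = k * (ϖE - Θ ϖE) := by rw [hkdef, div_mul_cancel₀ _ hs0]
  have hsub : (c - Θ c) - ρ (c - Θ c) = (k - ρ k) * (ϖE - Θ ϖE) := by rw [hck, map_mul, hρs]; ring
  rw [hsub, map_mul, hck, map_mul, mul_right_comm]
  exact mul_le_mul' (v_sub_map_le_of_thetaFixed hσ' hfix' hπ' hdd' jK hjv hjfix hjσ hΘk) le_rfl

/-! ## §3 The upper bound: a deep `ρ`-norm-one element is `Θ`-deeper by `d − 1` -/

/-- **UPPER BOUND.**  If `yρy = 1` and `|y − 1| ≤ exp(−s)` (`s ≥ 1`) then `|y − Θy| ≤ max(exp(−(s + d − 1)), exp(−2s))`: with the `ρ`-trace-one integer `a₀` and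
`c := ρ(a₀(y − 1))` one has `y = ρz∕z` for `z = 1 + c`, and `ρz·Θz − z·Θρz = −[((c−Θc) − ρ(c−Θc)) + (w − ρw)]`, `w = c·Θρc`. [cite: Serre1979, Ch. V §3 Prop. 5] [cite: Serre1979, Ch. X §1] -/
theorem v_sub_map_le_of_mul_map_eq_one (hρρ : ∀ x, ρ (ρ x) = x) (hvρ : ∀ x, Valued.v (ρ x) = Valued.v x) (hΘΘ : ∀ x, Θ (Θ x) = x)
    (hΘρ : ∀ x, Θ (ρ x) = ρ (Θ x)) (hvΘ : ∀ x, Valued.v (Θ x) = Valued.v x) (hα1 : Valued.v α ≤ 1) (hα : Valued.v (α - ρ α) = 1)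
    (hρϖE : ρ ϖE = ϖE) (hϖE : Valued.v ϖE = exp (-1 : ℤ))
    (hσ' : ∀ x, σ' (σ' x) = x) (hfix' : ∀ x : K', σ' x = x → x ≠ 0 → ∃ n : ℤ, Valued.v x = exp (2 * n))
    (hπ' : Valued.v π' = exp (-1 : ℤ)) (hdd' : Valued.v (π' - σ' π') = Valued.v π' ^ d)
    (jK : K' →+* K) (hjv : ∀ x, Valued.v (jK x) = Valued.v x) (hjfix : ∀ z : K, Θ z = z → ∃ x, jK x = z) (hjσ : ∀ x, jK (σ' x) = ρ (jK x))
    {y : K} (hy : y * ρ y = 1) {s : ℕ} (hs : 1 ≤ s) (hys : Valued.v (y - 1) ≤ exp (-(s : ℤ))) :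
    Valued.v (y - Θ y) ≤ max (exp (-((s : ℤ) + d - 1))) (exp (-(2 * (s : ℤ)))) := by
  obtain ⟨a₀, ha₀1, ha₀⟩ := exists_traceOne_of_unramified hρρ hvρ hα1 hα
  have hv1 : Valued.v (1 : K) = 1 := Valuation.map_one _
  obtain ⟨c, hcdef⟩ : ∃ c : K, c = ρ (a₀ * (y - 1)) := ⟨_, rfl⟩
  have hvc : Valued.v c ≤ exp (-(s : ℤ)) := by
    rw [hcdef, hvρ, map_mul]
    calc Valued.v a₀ * Valued.v (y - 1) ≤ 1 * exp (-(s : ℤ)) := mul_le_mul' ha₀1 hys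
      _ = exp (-(s : ℤ)) := one_mul _
  have hvc1 : Valued.v c < 1 := hvc.trans_lt (by rw [← exp_zero, exp_lt_exp]; omega)
  obtain ⟨z, hzdef⟩ : ∃ z : K, z = 1 + c := ⟨_, rfl⟩
  have hvz : Valued.v z = 1 := by
    rw [hzdef, Valuation.map_add_eq_of_lt_left Valued.v (x := (1 : K)) (y := c) (by rw [hv1]; exact hvc1), hv1]
  have hz0 : z ≠ 0 := fun h0 => by rw [h0, map_zero] at hvz; exact zero_ne_one hvz
  have hΘz0 : Θ z ≠ 0 := (map_ne_zero Θ).2 hz0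
  -- `y·z = ρz`
  have hρc : ρ c = a₀ * (y - 1) := by rw [hcdef, hρρ]
  have hyz : y * z = ρ z := by
    rw [hzdef, map_add, map_one, hρc, hcdef, map_mul, map_sub, map_one]
    have hρa : ρ a₀ = 1 - a₀ := by linear_combination ha₀
    rw [hρa]
    linear_combination (1 - a₀) * hy
  have hy' : y = ρ z / z := by rw [eq_div_iff hz0, hyz]
  -- the numerator identity
  have hΘy : Θ y = Θ (ρ z) / Θ z := by rw [hy', map_div₀]
  have hdiff : y - Θ y = (ρ z * Θ z - z * Θ (ρ z)) / (z * Θ z) := by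
    rw [hΘy, hy', div_sub_div _ _ hz0 hΘz0]
  have hnum : ρ z * Θ z - z * Θ (ρ z) = -(((c - Θ c) - ρ (c - Θ c)) + (c * Θ (ρ c) - ρ (c * Θ (ρ c)))) := by
    have h1 : ρ (c * Θ (ρ c)) = ρ c * Θ c := by rw [map_mul, ← hΘρ, hρρ]
    have h2 : ρ (c - Θ c) = ρ c - Θ (ρ c) := by rw [map_sub, ← hΘρ]
    rw [h1, h2, hzdef]
    simp only [map_add, map_one]
    ring
  -- the two estimates
  have hA : Valued.v ((c - Θ c) - ρ (c - Θ c)) ≤ exp (-((s : ℤ) + d - 1)) := by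
    refine (v_skew_sub_map_skew_le hΘΘ hΘρ hρϖE hϖE hσ' hfix' hπ' hdd' jK hjv hjfix hjσ c).trans ?_
    have hcΘ : Valued.v (c - Θ c) ≤ exp (-(s : ℤ)) := (Valuation.map_sub _ _ _).trans (max_le hvc (by rw [hvΘ]; exact hvc))
    calc Valued.v (c - Θ c) * exp (-((d : ℤ) - 1)) ≤ exp (-(s : ℤ)) * exp (-((d : ℤ) - 1)) := mul_le_mul' hcΘ le_rfl
      _ = exp (-((s : ℤ) + d - 1)) := by rw [← exp_add]; congr 1; ring
  have hB : Valued.v (c * Θ (ρ c) - ρ (c * Θ (ρ c))) ≤ exp (-(2 * (s : ℤ))) := by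
    have hw : Valued.v (c * Θ (ρ c)) ≤ exp (-(2 * (s : ℤ))) := by
      rw [map_mul, hvΘ, hvρ]
      calc Valued.v c * Valued.v c ≤ exp (-(s : ℤ)) * exp (-(s : ℤ)) := mul_le_mul' hvc hvc
        _ = exp (-(2 * (s : ℤ))) := by rw [← exp_add]; congr 1; ring
    exact (Valuation.map_sub _ _ _).trans (max_le hw (by rw [hvρ]; exact hw))
  rw [hdiff, map_div₀, map_mul, hvΘ, hvz, mul_one, div_one, hnum, Valuation.map_neg]
  exact (Valuation.map_add _ _ _).trans (max_le_max hA hB)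

/-! ## §4 Existence: a `Θ`-fixed `ρ`-norm-one element within `exp(−(jl − d + 1))` of `κ` -/

/-- **EXISTENCE.**  For `κρκ = 1` with `|κ − Θκ| ≤ exp(−jl)` and `2d ≤ jl + 1` there is a `Θ`-fixed `x` with `xρx = 1` and `|κ − x| ≤ exp(−(jl − d + 1))`:
`κ_a := bκ + Θ(bκ)` (`b` the `Θ`-trace-one integer) is `Θ`-fixed with `|κ − κ_a| ≤ exp(−jl)`, `f := κ_a ρκ_a` is `ρ`- and `Θ`-fixed with `|f − 1| ≤ exp(−jl)`, Serre's
sharp norm preimage on the third field (`[IsAdicComplete 𝓂[K'] 𝒪[K']]`) writes `f = NρN` with `|N − 1| ≤ exp(−(jl − d + 1))`, and `x := κ_a ∕ N`.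
[cite: Serre1979, Ch. V §3 Prop. 5, Cor. 3] [cite: Serre1979, Ch. III §3 Prop. 7] -/
theorem exists_thetaFixed_normOne_near [IsAdicComplete 𝓂[K'] 𝒪[K']]
    (hρρ : ∀ x, ρ (ρ x) = x) (hvρ : ∀ x, Valued.v (ρ x) = Valued.v x) (hΘΘ : ∀ x, Θ (Θ x) = x)
    (hΘρ : ∀ x, Θ (ρ x) = ρ (Θ x)) (hvΘ : ∀ x, Valued.v (Θ x) = Valued.v x) (hϖE : Valued.v ϖE = exp (-1 : ℤ)) (h2 : Valued.v (2 : K) = Valued.v ϖE ^ t)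
    (hσ' : ∀ x, σ' (σ' x) = x) (hvσ' : ∀ x, Valued.v (σ' x) = Valued.v x) (hfix' : ∀ x : K', σ' x = x → x ≠ 0 → ∃ n : ℤ, Valued.v x = exp (2 * n))
    (hπ' : Valued.v π' = exp (-1 : ℤ)) (hdd' : Valued.v (π' - σ' π') = Valued.v π' ^ d) (hd : 1 ≤ d)
    (jK : K' →+* K) (hjv : ∀ x, Valued.v (jK x) = Valued.v x) (hjΘ : ∀ x, Θ (jK x) = jK x)
    (hjfix : ∀ z : K, Θ z = z → ∃ x, jK x = z) (hjσ : ∀ x, jK (σ' x) = ρ (jK x))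
    (hnorm : ∀ z : Kˣ, Θ (z : K) = z → Valued.v (z : K) = 1 → ∃ ω : Kˣ, Valued.v (ω : K) = 1 ∧ (ω : K) * Θ ω = z)
    {κ : K} (hκ : κ * ρ κ = 1) {jl : ℕ} (hκΘ : Valued.v (κ - Θ κ) ≤ exp (-(jl : ℤ))) (hjl : 2 * d ≤ jl + 1) :
    ∃ x : K, Θ x = x ∧ x * ρ x = 1 ∧ Valued.v (κ - x) ≤ exp (-((jl : ℤ) - d + 1)) := by
  -- the `Θ`-fixed uniformiser `jK π'` and the `Θ`-trace-one integer `b`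
  have hπ : Valued.v (jK π') = exp (-1 : ℤ) := by rw [hjv, hπ']
  have h2' : Valued.v (2 : K) = Valued.v (jK π') ^ t := by rw [h2, hϖE, hπ]
  obtain ⟨b, hb1, hb⟩ := exists_traceOne_theta hΘΘ hvΘ (hjΘ π') hπ h2' hnorm
  have hjl1 : 1 ≤ jl := by omega
  have hκ1 : Valued.v κ = 1 := v_eq_one_of_v_mul_map_eq_one hvρ (by rw [hκ]; exact Valuation.map_one _)
  have hκ0 : κ ≠ 0 := fun h0 => by rw [h0, map_zero] at hκ1; exact zero_ne_one hκ1
  -- `κ_a = Tr_Θ(bκ)`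
  have hv1' : Valued.v (1 : K') = 1 := Valuation.map_one _
  obtain ⟨κa, hκadef⟩ : ∃ κa : K, κa = b * κ + Θ (b * κ) := ⟨_, rfl⟩
  have hΘκa : Θ κa = κa := by rw [hκadef, map_add, hΘΘ, add_comm]
  have hκκa : κ - κa = Θ b * (κ - Θ κ) := by
    have hΘb : Θ b = 1 - b := by linear_combination hb
    rw [hκadef, map_mul, hΘb]; ring
  have hvκκa : Valued.v (κ - κa) ≤ exp (-(jl : ℤ)) := by
    rw [hκκa, map_mul, hvΘ]
    calc Valued.v b * Valued.v (κ - Θ κ) ≤ 1 * exp (-(jl : ℤ)) := mul_le_mul' hb1 hκΘ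
      _ = exp (-(jl : ℤ)) := one_mul _
  have hlt1 : exp (-(jl : ℤ)) < 1 := by rw [← exp_zero, exp_lt_exp]; omega
  have hκa1 : Valued.v κa = 1 := by
    have h := Valuation.map_sub_eq_of_lt_left Valued.v (x := κ) (y := κ - κa) (by rw [hκ1]; exact hvκκa.trans_lt hlt1)
    rw [sub_sub_cancel] at h; rw [h, hκ1]
  have hκa0 : κa ≠ 0 := fun h0 => by rw [h0, map_zero] at hκa1; exact zero_ne_one hκa1
  -- `f = κ_a ρκ_a`, fixed by `ρ` and `Θ`, within `exp(−jl)` of `1`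
  obtain ⟨f, hfdef⟩ : ∃ f : K, f = κa * ρ κa := ⟨_, rfl⟩
  have hΘf : Θ f = f := by rw [hfdef, map_mul, hΘρ, hΘκa]
  have hρf : ρ f = f := by rw [hfdef, map_mul, hρρ, mul_comm]
  have hvf1 : Valued.v (f - 1) ≤ exp (-(jl : ℤ)) := by
    have hid : f - 1 = (κa - κ) * ρ κa + κ * ρ (κa - κ) := by rw [hfdef, map_sub]; linear_combination hκ
    rw [hid]
    refine (Valuation.map_add _ _ _).trans (max_le ?_ ?_)
    · rw [map_mul, hvρ, hκa1, mul_one, ← neg_sub κ κa, Valuation.map_neg]; exact hvκκa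
    · rw [map_mul, hκ1, one_mul, hvρ, ← neg_sub κ κa, Valuation.map_neg]; exact hvκκa
  obtain ⟨f', hf'⟩ := hjfix f hΘf
  have hσf' : σ' f' = f' := jK.injective (by rw [hjσ, hf', hρf])
  have hvf'1 : Valued.v (f' - 1) ≤ Valued.v π' ^ (2 * d) := by
    have hle : Valued.v (f' - 1) ≤ exp (-(jl : ℤ)) := by rw [← hjv, map_sub, map_one, hf']; exact hvf1
    rcases eq_or_ne (f' - 1) 0 with h0 | h0
    · rw [h0, map_zero]; exact zero_le
    · obtain ⟨n, hn⟩ := hfix' (f' - 1) (by rw [map_sub, hσf', map_one]) h0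
      rw [hn, exp_le_exp] at hle
      rw [hn, hπ', ← exp_nsmul, nsmul_eq_mul, exp_le_exp]; omega
  -- Serre V §3 Cor. 3 on the third field
  have ht' : Valued.v (2 : K') = Valued.v π' ^ t := by rw [← hjv, map_ofNat, h2, hϖE, hπ']
  obtain ⟨n', hn'f, hn'⟩ := exists_mul_map_eq_of_fixed_of_v_sub_one_le hσ' hvσ' hfix' hπ' hdd' ht' hσf' hvf'1
  have hvn'1 : Valued.v (n' - 1) ≤ exp (-((jl : ℤ) - d + 1)) := by
    -- `|n' − 1|·|π'|^d ≤ |f' − 1|·|π'| ≤ exp(−jl − 1)`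
    have hπd : Valued.v π' ^ d = exp (-(d : ℤ)) := by rw [hπ', ← exp_nsmul, nsmul_eq_mul, mul_neg, mul_one]
    have hle : Valued.v (n' - 1) * exp (-(d : ℤ)) ≤ exp (-(jl : ℤ)) * exp (-1 : ℤ) := by
      rw [← hπd, ← hπ']
      refine hn'.trans (mul_le_mul' ?_ le_rfl)
      rw [← hjv, map_sub, map_one, hf']; exact hvf1
    rw [← exp_add] at hle
    calc Valued.v (n' - 1) = Valued.v (n' - 1) * exp (-(d : ℤ)) * exp (d : ℤ) := by
          rw [mul_assoc, ← exp_add, neg_add_cancel, exp_zero, mul_one]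
      _ ≤ exp (-(jl : ℤ) + -1) * exp (d : ℤ) := mul_le_mul' hle le_rfl
      _ = exp (-((jl : ℤ) - d + 1)) := by rw [← exp_add]; congr 1; ring
  have hvn' : Valued.v n' = 1 := by
    have hlt : Valued.v (n' - 1) < 1 := hvn'1.trans_lt (by rw [← exp_zero, exp_lt_exp]; omega)
    have h := Valuation.map_add_eq_of_lt_left Valued.v (x := (1 : K')) (y := n' - 1) (by rw [hv1']; exact hlt)
    rw [add_sub_cancel, hv1'] at h; exact h
  have hn'0 : n' ≠ 0 := fun h0 => by rw [h0, map_zero] at hvn'; exact zero_ne_one hvn'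
  -- `x := κ_a ∕ N`, `N = jK n'`
  obtain ⟨N, hNdef⟩ : ∃ N : K, N = jK n' := ⟨_, rfl⟩
  have hN0 : N ≠ 0 := by rw [hNdef]; exact (map_ne_zero jK).2 hn'0
  have hvN : Valued.v N = 1 := by rw [hNdef, hjv, hvn']
  have hN1 : Valued.v (N - 1) = Valued.v (n' - 1) := by rw [hNdef, ← hjv (n' - 1), map_sub jK, map_one jK]
  have hNρN : N * ρ N = f := by rw [hNdef, ← hjσ, ← map_mul, hn'f, hf']
  have hf0 : f ≠ 0 := by rw [hfdef]; exact mul_ne_zero hκa0 ((map_ne_zero ρ).2 hκa0)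
  refine ⟨κa / N, by rw [map_div₀, hΘκa, hNdef, hjΘ], ?_, ?_⟩
  · rw [map_div₀, div_mul_div_comm, hNρN, ← hfdef, div_self hf0]
  · have hid : κ - κa / N = (κ - κa) + κa * (N - 1) / N := by field_simp; ring
    rw [hid]
    refine (Valuation.map_add _ _ _).trans (max_le (hvκκa.trans (by rw [exp_le_exp]; omega)) ?_)
    rw [map_div₀, map_mul, hκa1, one_mul, hvN, div_one, hN1]
    exact hvn'1

/-! ## §5 Coset representatives of the third-field torus -/

/-- **COSET REPRESENTATIVES**: a norm-one `x'` of the third field (`x'σ'x' = 1`) is `a∕σ'a` with `|a| = 1` (the unit coset `T♮⁰`) or with `|a| = |π'|` (the other coset) —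
Hilbert 90 ★ and the fixed rescaling by `(π'σ'π')^k`. [cite: Serre1979, Ch. X §1] [cite: Serre1979, Ch. V §3] -/
theorem exists_rep_of_mul_map_eq_one (hσ' : ∀ x, σ' (σ' x) = x) (hvσ' : ∀ x, Valued.v (σ' x) = Valued.v x)
    (hπ' : Valued.v π' = exp (-1 : ℤ)) (hdd' : Valued.v (π' - σ' π') = Valued.v π' ^ d) {x' : K'} (hx : x' * σ' x' = 1) :
    ∃ a : K', x' = a / σ' a ∧ (Valued.v a = 1 ∨ Valued.v a = Valued.v π') := by
  have hπ0 : π' ≠ 0 := (v_varpi_zpow hπ' 0).1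
  have hP0 : π' * σ' π' ≠ 0 := mul_ne_zero hπ0 ((map_ne_zero σ').2 hπ0)
  have hσP : σ' (π' * σ' π') = π' * σ' π' := map_mul_map hσ' π'
  have hσPk : ∀ k : ℤ, σ' ((π' * σ' π') ^ k) = (π' * σ' π') ^ k := fun k => by rw [map_zpow₀, hσP]
  have hvP : ∀ k : ℤ, Valued.v ((π' * σ' π') ^ k) = exp (-(2 * k)) := fun k => by
    rw [map_zpow₀, map_mul, hvσ', hπ', ← exp_add, ← exp_zsmul, smul_eq_mul]; congr 1; ring
  obtain ⟨a₀, ha₀, -, hxa⟩ := exists_eq_div_map_of_mul_map_eq_one hσ' (sub_map_ne_zero hπ' hdd') hx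
  obtain ⟨e, he⟩ : ∃ e : ℤ, Valued.v a₀ = exp e := ⟨_, (exp_log ((Valuation.ne_zero_iff _).2 ha₀)).symm⟩
  obtain ⟨k, hk | hk⟩ := Int.even_or_odd' e
  · refine ⟨a₀ * (π' * σ' π') ^ k, ?_, Or.inl ?_⟩
    · rw [hxa, div_map_eq_of_mul_fixed (hσPk k) (zpow_ne_zero _ hP0)]
    · rw [map_mul, he, hvP, ← exp_add, ← exp_zero]; congr 1; omega
  · refine ⟨a₀ * (π' * σ' π') ^ (k + 1), ?_, Or.inr ?_⟩
    · rw [hxa, div_map_eq_of_mul_fixed (hσPk (k + 1)) (zpow_ne_zero _ hP0)]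
    · rw [map_mul, he, hvP, ← exp_add, hπ']; congr 1; omega

end Summit.HodgeConjecture.HodgeConjecture.Cruxes.H413.F0P3cDyRamToricLevelCensusUnr
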